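import Mathlib.Analysis.Calculus.FDeriv.Symmetric
import Mathlib.Analysis.Calculus.LineDeriv.IntegrationByParts
import Mathlib.Analysis.InnerProductSpace.PiL2
import Mathlib.MeasureTheory.Measure.Haar.InnerProductSpace
import Mathlib.Analysis.SpecialFunctions.Trigonometric.Deriv
import HarnessLib

/-!
# Convex integration in 2-D: calculus kit on space–time `ℝ × ℝ²`

Topic `Analysis/FluidPDE`. Support file for the proof of the named fact
`ConvexIntegrationLemma2DBall` (Chiodaroli–De Lellis–Kreml, CPAM 68 (2015), Lemma 3.7 on a
ball; file `ConvexIntegration2DReduction.lean`). Everything here is elementary calculus on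
`ST = ℝ × EuclideanSpace ℝ (Fin 2)` (time first, product metric and product Lebesgue measure),
phrased for *scalar* functions `ST → ℝ` and the partial-derivative operator
`pd e f = (z ↦ Df(z) e)`:

* smoothness / support / Schwarz (`pd_comm`), linearity and the Leibniz rule for `pd`;
* integration by parts `∫ ∂_e f · g = -∫ f · ∂_e g` for `C¹` functions with `f` compactly
  supported (from Mathlib's `integral_mul_fderiv_eq_neg_fderiv_mul_of_integrable`) and
  `∫ ∂_e f = 0`;
* linear phases `phaseL η` and the oscillation profiles `osc η N k = cos (N φ_η + kπ/2)`
  (so that `∂_e osc_k = N φ_η(e) osc_{k+1}`), the one-step and the third-order Leibniz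
  expansions of `∂³(ψ · osc_k)` (`pd3_mul_osc`), which is the computation behind
  "`‖U - φ A(∂)(κ)‖₀ ≤ C λ N⁻¹`" in CDK 2015, proof of Prop. 4.1;
* the non-stationary-phase bound `|∫ F osc_k| ≤ ‖∂_e F‖_{L¹} / (N |φ_η(e)|)` and its
  consequence `∫ F cos(Nφ_η + kπ/2) → 0` (`N → ∞`) for `F ∈ C¹_c`, `η ≠ 0` — the quantitative
  Riemann–Lebesgue lemma that replaces weak-* convergence arguments in CDK 2015, §4.1.

## References

* E. Chiodaroli, C. De Lellis, O. Kreml, *Global ill-posedness of the isentropic system of gas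
  dynamics*, Comm. Pure Appl. Math. 68 (2015) 1157–1190, §4 (proof of Lemma 3.7).
-/

noncomputable section

open MeasureTheory Set Metric Filter Function
open scoped ContDiff Topology

namespace Literature.Analysis.FluidPDE.ConvexIntegration

/-- The plane `ℝ²` as a Euclidean space. [folklore] -/
abbrev E2 : Type := EuclideanSpace ℝ (Fin 2)

/-- Space–time `ℝ × ℝ²`, time first (product/sup metric, product Lebesgue measure). [folklore] -/
abbrev ST : Type := ℝ × E2

/-- Lebesgue measure on `ℝ × ℝ²` is an additive Haar measure (Mathlib's instance for
`Measure.prod`, re-exposed for `volume` on the product, which instance search does not unfold).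
[folklore] -/
instance instIsAddHaarMeasureVolumeST : (volume : Measure ST).IsAddHaarMeasure :=
  Measure.prod.instIsAddHaarMeasure _ _

/-- The time direction `(1, 0)`. [folklore] -/
def dT : ST := (1, 0)

/-- The spatial coordinate directions `(0, e_j)`. [folklore] -/
def dX (j : Fin 2) : ST := (0, EuclideanSpace.single j 1)

/-- Partial derivative of a scalar function in the direction `e`: `∂_e f (z) = Df(z) e`.
[folklore] -/
def pd (e : ST) (f : ST → ℝ) : ST → ℝ := fun z => fderiv ℝ f z e

/-- Unfolding of `pd`. [folklore] -/
theorem pd_apply (e : ST) (f : ST → ℝ) (z : ST) : pd e f z = fderiv ℝ f z e := rfl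

/-! ### Smoothness, support -/

/-- `2 ≤ ∞` in the smoothness exponents. [folklore] -/
theorem two_le_infty : (2 : ℕ∞ω) ≤ ∞ := WithTop.coe_le_coe.mpr le_top
/-- `1 ≤ ∞` in the smoothness exponents. [folklore] -/
theorem one_le_infty : (1 : ℕ∞ω) ≤ ∞ := WithTop.coe_le_coe.mpr le_top

/-- A partial derivative of a smooth function is smooth. [folklore] -/
theorem contDiff_pd {f : ST → ℝ} (hf : ContDiff ℝ ∞ f) (e : ST) : ContDiff ℝ ∞ (pd e f) :=
  (hf.fderiv_right (m := ∞) (by norm_cast)).clm_apply contDiff_const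

/-- A partial derivative of a `C²` function is `C¹`. [folklore] -/
theorem contDiff_one_pd {f : ST → ℝ} (hf : ContDiff ℝ 2 f) (e : ST) : ContDiff ℝ 1 (pd e f) :=
  (hf.fderiv_right (m := 1) (by norm_cast)).clm_apply contDiff_const

/-- A partial derivative of a `C¹` function is continuous. [folklore] -/
theorem continuous_pd {f : ST → ℝ} (hf : ContDiff ℝ 1 f) (e : ST) : Continuous (pd e f) :=
  (hf.continuous_fderiv one_ne_zero).clm_apply continuous_const

/-- Partial derivatives preserve compact support. [folklore] -/
theorem hasCompactSupport_pd {f : ST → ℝ} (hf : HasCompactSupport f) (e : ST) :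
    HasCompactSupport (pd e f) :=
  hf.fderiv_apply (𝕜 := ℝ) e

/-- The support of a partial derivative lies in the support of the function. [folklore] -/
theorem tsupport_pd_subset (e : ST) (f : ST → ℝ) : tsupport (pd e f) ⊆ tsupport f :=
  (tsupport_fderiv_apply_subset ℝ e)

/-- A partial derivative vanishes off the support of the function. [folklore] -/
theorem pd_eq_zero_of_notMem {f : ST → ℝ} {e z : ST} (hz : z ∉ tsupport f) : pd e f z = 0 :=
  image_eq_zero_of_notMem_tsupport fun h => hz (tsupport_pd_subset e f h)

/-! ### Schwarz -/

/-- Mixed partial derivatives of a `C²` function commute. [folklore] -/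
theorem pd_comm {f : ST → ℝ} (hf : ContDiff ℝ 2 f) (a b : ST) :
    pd a (pd b f) = pd b (pd a f) := by
  funext x
  show fderiv ℝ (fun y => fderiv ℝ f y b) x a = fderiv ℝ (fun y => fderiv ℝ f y a) x b
  have hd : DifferentiableAt ℝ (fderiv ℝ f) x :=
    ((hf.fderiv_right (m := 1) le_rfl).differentiable one_ne_zero) x
  have h22 : minSmoothness ℝ 2 ≤ (2 : ℕ∞ω) := by
    rw [minSmoothness_of_isRCLikeNormedField]
  have key : ∀ c d : ST, fderiv ℝ (fun y => fderiv ℝ f y c) x d = fderiv ℝ (fderiv ℝ f) x d c := by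
    intro c d
    rw [fderiv_clm_apply hd (differentiableAt_const c)]
    simp
  rw [key, key]
  exact (hf.contDiffAt.isSymmSndFDerivAt h22).eq a b

/-- Mixed partial derivatives of a smooth function commute. [folklore] -/
theorem pd_comm_smooth {f : ST → ℝ} (hf : ContDiff ℝ ∞ f) (a b : ST) :
    pd a (pd b f) = pd b (pd a f) :=
  pd_comm (hf.of_le two_le_infty) a b

/-! ### Linearity and Leibniz -/

/-- `∂_e (f + g) = ∂_e f + ∂_e g`. [folklore] -/
theorem pd_add {f g : ST → ℝ} (hf : Differentiable ℝ f) (hg : Differentiable ℝ g) (e : ST) :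
    pd e (fun z => f z + g z) = fun z => pd e f z + pd e g z := by
  funext z; simp only [pd, fderiv_fun_add (hf z) (hg z), _root_.add_apply]

/-- `∂_e (f - g) = ∂_e f - ∂_e g`. [folklore] -/
theorem pd_sub {f g : ST → ℝ} (hf : Differentiable ℝ f) (hg : Differentiable ℝ g) (e : ST) :
    pd e (fun z => f z - g z) = fun z => pd e f z - pd e g z := by
  funext z; simp only [pd, fderiv_fun_sub (hf z) (hg z), _root_.sub_apply]

/-- `∂_e (-f) = -∂_e f`. [folklore] -/
theorem pd_neg (f : ST → ℝ) (e : ST) : pd e (fun z => -f z) = fun z => -pd e f z := by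
  funext z; simp only [pd, fderiv_fun_neg, _root_.neg_apply]

/-- `∂_e (c f) = c ∂_e f`. [folklore] -/
theorem pd_const_mul {f : ST → ℝ} (hf : Differentiable ℝ f) (c : ℝ) (e : ST) :
    pd e (fun z => c * f z) = fun z => c * pd e f z := by
  funext z
  simp only [pd, fderiv_const_mul (hf z), _root_.smul_apply, smul_eq_mul]

/-- Constants have vanishing partial derivatives. [folklore] -/
theorem pd_const (c : ℝ) (e : ST) : pd e (fun _ => c) = fun _ => 0 := by
  funext z; simp [pd]

/-- Leibniz rule `∂_e (f g) = f ∂_e g + g ∂_e f`. [folklore] -/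
theorem pd_mul {f g : ST → ℝ} (hf : Differentiable ℝ f) (hg : Differentiable ℝ g) (e : ST) :
    pd e (fun z => f z * g z) = fun z => f z * pd e g z + g z * pd e f z := by
  funext z
  simp only [pd, fderiv_fun_mul (hf z) (hg z), _root_.add_apply,
    _root_.smul_apply, smul_eq_mul]

/-- `∂_e` of a finite sum. [folklore] -/
theorem pd_finset_sum {ι : Type*} (s : Finset ι) {f : ι → ST → ℝ}
    (hf : ∀ i ∈ s, Differentiable ℝ (f i)) (e : ST) :
    pd e (fun z => ∑ i ∈ s, f i z) = fun z => ∑ i ∈ s, pd e (f i) z := by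
  funext z
  simp only [pd, fderiv_fun_sum fun i hi => (hf i hi z), _root_.sum_apply]

/-! ### Integration by parts -/

/-- `∫ ∂_e f · g = -∫ f · ∂_e g` for `C¹` functions, `f` compactly supported. [folklore] -/
theorem integral_pd_mul_eq_neg {f g : ST → ℝ} (hf : ContDiff ℝ 1 f) (hg : ContDiff ℝ 1 g)
    (hfc : HasCompactSupport f) (e : ST) :
    ∫ z, pd e f z * g z = - ∫ z, f z * pd e g z := by
  have h1 : Integrable (fun z => fderiv ℝ f z e * g z) :=
    ((continuous_pd hf e).mul hg.continuous).integrable_of_hasCompactSupport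
      ((hasCompactSupport_pd hfc e).mul_right)
  have h2 : Integrable (fun z => f z * fderiv ℝ g z e) :=
    (hf.continuous.mul (continuous_pd hg e)).integrable_of_hasCompactSupport hfc.mul_right
  have h3 : Integrable (fun z => f z * g z) :=
    (hf.continuous.mul hg.continuous).integrable_of_hasCompactSupport hfc.mul_right
  have := integral_mul_fderiv_eq_neg_fderiv_mul_of_integrable (μ := (volume : Measure ST))
    h1 h2 h3 (fun x _ => hf.differentiable one_ne_zero x)
    (fun x _ => hg.differentiable one_ne_zero x)
  simp only [pd]
  linarith

/-- `∫ ∂_e f = 0` for a compactly supported `C¹` function. [folklore] -/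
theorem integral_pd_eq_zero {f : ST → ℝ} (hf : ContDiff ℝ 1 f) (hfc : HasCompactSupport f)
    (e : ST) : ∫ z, pd e f z = 0 := by
  have h := integral_pd_mul_eq_neg hf contDiff_const hfc e (g := fun _ => (1 : ℝ))
  simp only [mul_one, pd_const, mul_zero, integral_zero, neg_zero] at h
  simpa using h

/-! ### Linear phases and oscillations -/

/-- The linear phase `z ↦ η.1 t + ⟪η.2, x⟫` as a continuous linear form. [folklore] -/
def phaseL (η : ST) : ST →L[ℝ] ℝ :=
  η.1 • ContinuousLinearMap.fst ℝ ℝ E2 + (innerSL ℝ η.2).comp (ContinuousLinearMap.snd ℝ ℝ E2)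

/-- Formula for the linear phase. [folklore] -/
theorem phaseL_apply (η z : ST) : phaseL η z = η.1 * z.1 + inner ℝ η.2 z.2 := by
  simp [phaseL]

/-- The phase in the time direction is the time frequency. [folklore] -/
theorem phaseL_dT (η : ST) : phaseL η dT = η.1 := by
  simp [phaseL_apply, dT]

/-- The phase in a space direction is the corresponding spatial frequency. [folklore] -/
theorem phaseL_dX (η : ST) (j : Fin 2) : phaseL η (dX j) = η.2 j := by
  simp [phaseL_apply, dX, EuclideanSpace.inner_single_right]

/-- `φ_η(η) = η₀² + |η'|²`. [folklore] -/
theorem phaseL_self (η : ST) : phaseL η η = η.1 ^ 2 + ‖η.2‖ ^ 2 := by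
  rw [phaseL_apply, real_inner_self_eq_norm_sq]; ring

/-- `φ_η(η) > 0` for `η ≠ 0`. [folklore] -/
theorem phaseL_self_pos {η : ST} (hη : η ≠ 0) : 0 < phaseL η η := by
  rw [phaseL_self]
  rcases η with ⟨a, b⟩
  by_cases ha : a = 0
  · subst ha
    have hb : b ≠ 0 := fun hb => hη (by simp [hb])
    have : 0 < ‖b‖ := norm_pos_iff.mpr hb
    positivity
  · have : 0 < a ^ 2 := by positivity
    positivity

/-- The oscillation `cos (N φ_η(z) + k π/2)`, i.e. the `k`-th derivative profile of `cos`.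
[folklore] -/
def osc (η : ST) (N : ℝ) (k : ℕ) : ST → ℝ := fun z => Real.cos (N * phaseL η z + k * (Real.pi / 2))

/-- Oscillations are bounded by `1`. [folklore] -/
theorem abs_osc_le_one (η : ST) (N : ℝ) (k : ℕ) (z : ST) : |osc η N k z| ≤ 1 :=
  Real.abs_cos_le_one _

/-- The derivative profiles of `cos` are `4`-periodic. [folklore] -/
theorem osc_add_four (η : ST) (N : ℝ) (k : ℕ) : osc η N (k + 4) = osc η N k := by
  funext z
  simp only [osc]
  have : (((k + 4 : ℕ) : ℝ)) * (Real.pi / 2) = k * (Real.pi / 2) + 2 * Real.pi := by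
    push_cast; ring
  rw [this, ← add_assoc, Real.cos_add_two_pi]

/-- Oscillations are smooth. [folklore] -/
theorem contDiff_osc (η : ST) (N : ℝ) (k : ℕ) : ContDiff ℝ ∞ (osc η N k) := by
  unfold osc
  fun_prop

/-- Derivative of an oscillation: `D osc_k (z) = N osc_{k+1}(z) φ_η`. [folklore] -/
theorem hasFDerivAt_osc (η : ST) (N : ℝ) (k : ℕ) (z : ST) :
    HasFDerivAt (osc η N k) ((N * osc η N (k + 1) z) • phaseL η) z := by
  have h1 : HasFDerivAt (fun z : ST => N * phaseL η z + k * (Real.pi / 2)) (N • phaseL η) z := by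
    have := ((phaseL η).hasFDerivAt (x := z)).const_mul N
    simpa using this.add_const (k * (Real.pi / 2))
  have h2 : HasFDerivAt (osc η N k)
      ((-Real.sin (N * phaseL η z + k * (Real.pi / 2))) • (N • phaseL η)) z :=
    (Real.hasDerivAt_cos (N * phaseL η z + k * (Real.pi / 2))).comp_hasFDerivAt z h1
  have h3 : -Real.sin (N * phaseL η z + k * (Real.pi / 2)) = osc η N (k + 1) z := by
    simp only [osc]
    push_cast
    rw [show N * phaseL η z + (k + 1) * (Real.pi / 2)
        = N * phaseL η z + k * (Real.pi / 2) + Real.pi / 2 by ring, Real.cos_add_pi_div_two]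
  refine h2.congr_fderiv ?_
  rw [smul_smul, h3, mul_comm]

/-- Oscillations are differentiable. [folklore] -/
theorem differentiable_osc (η : ST) (N : ℝ) (k : ℕ) : Differentiable ℝ (osc η N k) :=
  fun z => (hasFDerivAt_osc η N k z).differentiableAt

/-- `∂_e osc_k = N φ_η(e) osc_{k+1}`. [folklore] -/
theorem pd_osc (η : ST) (N : ℝ) (k : ℕ) (e : ST) :
    pd e (osc η N k) = fun z => N * phaseL η e * osc η N (k + 1) z := by
  funext z
  rw [pd_apply, (hasFDerivAt_osc η N k z).fderiv]
  simp only [_root_.smul_apply, smul_eq_mul]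
  ring

/-- Leibniz rule against an oscillation:
`∂_e (ψ · osc_k) = ∂_e ψ · osc_k + N φ_η(e) ψ · osc_{k+1}`. [folklore] -/
theorem pd_mul_osc {ψ : ST → ℝ} (hψ : Differentiable ℝ ψ) (η : ST) (N : ℝ) (k : ℕ) (e : ST) :
    pd e (fun z => ψ z * osc η N k z)
      = fun z => pd e ψ z * osc η N k z + ψ z * (N * phaseL η e) * osc η N (k + 1) z := by
  rw [pd_mul hψ (differentiable_osc η N k), pd_osc]
  funext z; ring

/-! ### The oscillatory integral bound -/

/-- **Non-stationary phase, one integration by parts.** For `F ∈ C¹_c` and `N > 0`,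
`|∫ F · cos(N φ_η + kπ/2)| ≤ ‖∂_e F‖_{L¹} / (N |φ_η(e)|)`. [folklore] -/
theorem abs_integral_mul_osc_le {F : ST → ℝ} (hF : ContDiff ℝ 1 F) (hFc : HasCompactSupport F)
    (η : ST) {N : ℝ} (hN : 0 < N) (k : ℕ) {e : ST} (he : phaseL η e ≠ 0) :
    |∫ z, F z * osc η N k z| ≤ (∫ z, |pd e F z|) / (N * |phaseL η e|) := by
  have hc : N * phaseL η e ≠ 0 := mul_ne_zero hN.ne' he
  -- `osc_k = ∂_e osc_{k+3} / (N φ_η e)`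
  have hosc : ∀ z, osc η N k z = pd e (osc η N (k + 3)) z / (N * phaseL η e) := by
    intro z
    rw [pd_osc, show k + 3 + 1 = k + 4 by ring, osc_add_four]
    field_simp
  have h1 : ∫ z, F z * osc η N k z = (∫ z, F z * pd e (osc η N (k + 3)) z) / (N * phaseL η e) := by
    rw [← integral_div]
    refine integral_congr_ae (Eventually.of_forall fun z => ?_)
    simp only [hosc z]
    ring
  rw [h1, ← neg_neg (∫ z, F z * pd e (osc η N (k + 3)) z),
    ← integral_pd_mul_eq_neg hF ((contDiff_osc η N (k + 3)).of_le one_le_infty) hFc e,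
    abs_div, abs_neg, abs_mul, abs_of_pos hN]
  gcongr
  calc |∫ z, pd e F z * osc η N (k + 3) z| ≤ ∫ z, |pd e F z * osc η N (k + 3) z| :=
        abs_integral_le_integral_abs
    _ ≤ ∫ z, |pd e F z| := by
        refine integral_mono_of_nonneg (Eventually.of_forall fun z => abs_nonneg _) ?_
          (Eventually.of_forall fun z => ?_)
        · exact ((continuous_pd hF e).abs).integrable_of_hasCompactSupport
            (hasCompactSupport_pd hFc e).abs
        · simp only
          rw [abs_mul]
          exact mul_le_of_le_one_right (abs_nonneg _) (abs_osc_le_one _ _ _ _)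

/-- **Riemann–Lebesgue for `C¹_c` amplitudes (quantitative form).** `∫ F cos(Nφ_η + kπ/2) → 0`
as `N → ∞`, for `η ≠ 0`. [folklore] -/
theorem tendsto_integral_mul_osc {F : ST → ℝ} (hF : ContDiff ℝ 1 F) (hFc : HasCompactSupport F)
    {η : ST} (hη : η ≠ 0) (k : ℕ) :
    Tendsto (fun N : ℝ => ∫ z, F z * osc η N k z) atTop (𝓝 0) := by
  have hpos := phaseL_self_pos hη
  set K : ℝ := (∫ z, |pd η F z|) / |phaseL η η|
  have hb : Tendsto (fun N : ℝ => K / N) atTop (𝓝 0) := tendsto_const_nhds.div_atTop tendsto_id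
  rw [tendsto_zero_iff_abs_tendsto_zero]
  refine squeeze_zero' (Eventually.of_forall fun N => abs_nonneg _) ?_ hb
  filter_upwards [eventually_gt_atTop (0 : ℝ)] with N hN
  calc |∫ z, F z * osc η N k z| ≤ (∫ z, |pd η F z|) / (N * |phaseL η η|) :=
        abs_integral_mul_osc_le hF hFc η hN k hpos.ne'
    _ = K / N := by simp only [K]; field_simp


/-! ### Third-order Leibniz expansion against an oscillation -/

section Expansion

variable {ψ : ST → ℝ} (η : ST) (N : ℝ)

/-- Smooth functions are differentiable. [folklore] -/
theorem differentiable_of_smooth {φ : ST → ℝ} (hφ : ContDiff ℝ ∞ φ) : Differentiable ℝ φ :=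
  hφ.differentiable (by simp)

/-- Constant multiples of smooth functions are smooth. [folklore] -/
theorem contDiff_const_mul_smooth {φ : ST → ℝ} (hφ : ContDiff ℝ ∞ φ) (r : ℝ) :
    ContDiff ℝ ∞ (fun z => r * φ z) :=
  contDiff_const.mul hφ

/-- `r ψ osc_k` is differentiable for differentiable `ψ`. [folklore] -/
theorem differentiable_mul_osc {φ : ST → ℝ} (hφ : Differentiable ℝ φ) (r : ℝ) (k : ℕ) :
    Differentiable ℝ (fun z => r * φ z * osc η N k z) :=
  ((differentiable_const r).mul hφ).mul (differentiable_osc η N k)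

/-- One Leibniz step in scaled form:
`∂_e (r ψ osc_k) = r ∂_eψ osc_k + r N φ_η(e) ψ osc_{k+1}`. [folklore] -/
theorem pd_const_mul_mul_osc (hψ : Differentiable ℝ ψ) (r : ℝ) (k : ℕ) (e : ST) :
    pd e (fun z => r * ψ z * osc η N k z)
      = fun z => r * pd e ψ z * osc η N k z
          + r * (N * phaseL η e) * ψ z * osc η N (k + 1) z := by
  have h1 : (fun z => r * ψ z * osc η N k z) = fun z => (fun y => r * ψ y) z * osc η N k z := rfl
  have h2 : Differentiable ℝ (fun y => r * ψ y) := (differentiable_const r).mul hψ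
  rw [h1, pd_mul_osc h2, pd_const_mul hψ]
  funext z; ring

/-- **Third-order Leibniz expansion.** For smooth `ψ`,
`∂_a∂_b∂_c (ψ osc_k) = N³ φ_aφ_bφ_c ψ osc_{k+3} + N² (…) osc_{k+2} + N (…) osc_{k+1} + (∂³ψ) osc_k`.
[folklore] -/
theorem pd3_mul_osc (hψ : ContDiff ℝ ∞ ψ) (k : ℕ) (a b c : ST) :
    pd a (pd b (pd c (fun z => ψ z * osc η N k z))) = fun z =>
      pd a (pd b (pd c ψ)) z * osc η N k z
      + N * ((phaseL η a * pd b (pd c ψ) z + phaseL η b * pd a (pd c ψ) z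
              + phaseL η c * pd a (pd b ψ) z) * osc η N (k + 1) z)
      + N ^ 2 * ((phaseL η a * phaseL η b * pd c ψ z + phaseL η a * phaseL η c * pd b ψ z
              + phaseL η b * phaseL η c * pd a ψ z) * osc η N (k + 2) z)
      + N ^ 3 * (phaseL η a * phaseL η b * phaseL η c * ψ z * osc η N (k + 3) z) := by
  -- smoothness bookkeeping
  have hψd := differentiable_of_smooth hψ
  have hc := contDiff_pd hψ c
  have hb := contDiff_pd hψ b
  have hbc := contDiff_pd hc b
  have hcd := differentiable_of_smooth hc
  have hbd := differentiable_of_smooth hb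
  have hbcd := differentiable_of_smooth hbc
  -- step 1
  have e1 : (fun z => ψ z * osc η N k z) = fun z => 1 * ψ z * osc η N k z := by
    funext z; ring
  rw [e1, pd_const_mul_mul_osc η N hψd 1 k c]
  -- step 2
  rw [pd_add (differentiable_mul_osc η N hcd _ _) (differentiable_mul_osc η N hψd _ _),
    pd_const_mul_mul_osc η N hcd, pd_const_mul_mul_osc η N hψd]
  -- step 3
  have hs1 : Differentiable ℝ (fun z => 1 * pd b (pd c ψ) z * osc η N k z
      + 1 * (N * phaseL η b) * pd c ψ z * osc η N (k + 1) z) :=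
    (differentiable_mul_osc η N hbcd _ _).add (differentiable_mul_osc η N hcd _ _)
  have hs2 : Differentiable ℝ (fun z => 1 * (N * phaseL η c) * pd b ψ z * osc η N (k + 1) z
      + 1 * (N * phaseL η c) * (N * phaseL η b) * ψ z * osc η N (k + 1 + 1) z) :=
    (differentiable_mul_osc η N hbd _ _).add (differentiable_mul_osc η N hψd _ _)
  rw [pd_add hs1 hs2,
    pd_add (differentiable_mul_osc η N hbcd _ _) (differentiable_mul_osc η N hcd _ _),
    pd_add (differentiable_mul_osc η N hbd _ _) (differentiable_mul_osc η N hψd _ _),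
    pd_const_mul_mul_osc η N hbcd, pd_const_mul_mul_osc η N hcd,
    pd_const_mul_mul_osc η N hbd, pd_const_mul_mul_osc η N hψd]
  -- normalise the mixed partials and collect
  have e2 : pd a (pd c ψ) = pd c (pd a ψ) := pd_comm_smooth hψ a c
  have e3 : pd b (pd c ψ) = pd c (pd b ψ) := pd_comm_smooth hψ b c
  have e4 : pd a (pd b ψ) = pd b (pd a ψ) := pd_comm_smooth hψ a b
  funext z
  simp only [e3]
  rw [show pd a (pd c (pd b ψ)) z = pd c (pd a (pd b ψ)) z by rw [pd_comm_smooth hb a c],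
    show pd a (pd c ψ) z = pd c (pd a ψ) z by rw [e2]]
  ring

end Expansion

/-! ### Bounds for compactly supported continuous functions -/

/-- A compactly supported continuous function is bounded (with a non-negative bound). [folklore] -/
theorem exists_forall_abs_le {f : ST → ℝ} (hf : Continuous f) (hfc : HasCompactSupport f) :
    ∃ K : ℝ, 0 ≤ K ∧ ∀ z, |f z| ≤ K := by
  obtain ⟨K, hK⟩ := hf.bounded_above_of_compact_support hfc
  refine ⟨max K 0, le_max_right _ _, fun z => ?_⟩
  exact (Real.norm_eq_abs _ ▸ hK z).trans (le_max_left _ _)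

end Literature.Analysis.FluidPDE.ConvexIntegration
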